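import Summits.AnomalousDissipation.AnomalousDissipation.Theses.TameRoughRigidity
import Summits.AnomalousDissipation.AnomalousDissipation.Theorems.EnsembleRigidityResidualTransferSSS
import HarnessLib

/-!
# Route TameRoughRigidity — support `ResidualTransferSSS`

Proof of the route declaration
`Summit.AnomalousDissipation.AnomalousDissipation.Theses.TameRoughRigidity.ResidualTransferSSS`
(item stmt-AnomalousDissipation-18616): RESIDUAL TRANSFER AT THE ENSEMBLE LEVEL. For `ν > 0`, a smooth
force `f` and every stationary statistical solution `μ` of NS_ν(f) on `T³` (Foias–Manley–Rosa–Temam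
2001, Ch. IV Def. 1.3, (1.29)–(1.31)): (a) the work of the force is non-negative on every energy
shell, and (b) for every cylindrical test functional `Φ` the forced-Euler generator
`⟨f − B(v,v), Φ'(v)⟩` is `μ`-integrable with
`|∫ ⟨f − B(v,v), Φ'(v)⟩ dμ| ≤ ν (ensembleEnstrophy μ)^{1/2} (∫ ‖∇Φ'(v)‖² dμ)^{1/2}`.

The item is, by design of the route (rev 1, cone repair 2026-08-17), a byte-identical copy of the
parent route's bridge item `EnsembleRigidity.ResidualTransferSSS` (stmt-AnomalousDissipation-15510),
which is already proved in the tree by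
`Summit.AnomalousDissipation.AnomalousDissipation.Theorems.ResidualTransferSSS.ResidualTransferSSS_of`
(`Theorems/EnsembleRigidityResidualTransferSSS.lean`). The two route declarations unfold to the same
proposition, so the proof here is that theorem. Nothing else is in this file: the route file
`Theses/TameRoughRigidity.lean` deliberately takes the item as a hypothesis of `closes` so that it
need not import any `Theorems` module; this file is where that import lives.

## References

* C. Foias, O. Manley, R. Rosa, R. Temam, *Navier–Stokes Equations and Turbulence* (CUP 2001),
  Ch. IV §1.1, §1.2 Def. 1.3, (1.29)–(1.31). [FoiasManleyRosaTemam2001]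
-/

-- `Summit.<Summit>.<Problem>` is the tree's mandated summit-side namespace (CONVENTIONS §2); single-conjunct summit, duplicate deliberate.
set_option linter.dupNamespace false

namespace Summit.AnomalousDissipation.AnomalousDissipation.Theorems.TameRoughRigidity

/-- **Residual transfer at the ensemble level** — the route declaration
`TameRoughRigidity.ResidualTransferSSS` (item stmt-AnomalousDissipation-18616): for `ν > 0`, `f`
smooth (divergence-free, mean-zero) and every stationary statistical solution `μ` of NS_ν(f) on `T³`
with integrable energy, (a) `0 ≤ ∫_{e₁ ≤ |v|² < e₂} (v, f) dμ` on every energy shell and (b) the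
cylindrical forced-Euler defect is at most `ν · √(ensembleEnstrophy μ) · ‖∇Φ'‖_{L²(μ)}`. It is the
parent route's bridge item `EnsembleRigidity.ResidualTransferSSS` verbatim, proved by
`Theorems.ResidualTransferSSS.ResidualTransferSSS_of` (FMRT 2001, Ch. IV (1.29)–(1.31)). [folklore] -/
theorem residualTransferSSS_proof :
    Summit.AnomalousDissipation.AnomalousDissipation.Theses.TameRoughRigidity.ResidualTransferSSS := by
  unfold Summit.AnomalousDissipation.AnomalousDissipation.Theses.TameRoughRigidity.ResidualTransferSSS
  exact Summit.AnomalousDissipation.AnomalousDissipation.Theorems.ResidualTransferSSS.ResidualTransferSSS_of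

end Summit.AnomalousDissipation.AnomalousDissipation.Theorems.TameRoughRigidity
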